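import Literature.Geometry.Riemannian.RicciFlowConjugateHeatKernel
import Literature.Geometry.Manifold.TimeDerivativeSmooth
import HarnessLib

/-!
# Integrability and `L¹` comparison of the conjugate heat kernels of a Ricci flow
# (auxiliaries for the regularity in the base point; Bamler 2020a, §2.3)

Three auxiliary statements about the densities `K` with `ν_{x,t;s} = K(·, s) dV_{h(s)}` of the heat
kernel measures of a `C^∞` family `h` of Riemannian metrics on a closed manifold `M` (modelled on
`ℝᵐ`) which is a Ricci flow on `[s, t]` / `[a, t]` (`IsRicciFlow.exists_conjugateHeatKernel`,
`RicciFlowConjugateHeatKernel.lean`):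

* `heatBracket_eq_zero_of_notMem_tsupport` — the adjoint bracket
  `−∂_σ(ρζ) − ρ Δ_{h(σ)}ζ + ρ Q ζ` of the very weak formulation vanishes outside `tsupport ζ`;
* `IsRicciFlow.ofReal_integral_abs_sub_le` — **`∫ |K − K'| dV_s ≤ (π (t − s))^{-1/2} d_{h(t)}(x, x')`**
  for the densities of `ν_{x,t;s}`, `ν_{x',t;s}` (the total variation form of the strong Feller
  bound `IsRicciFlow.ofReal_abs_integral_sub_integral_le_of_measurable`, tested on
  `sign (K − K')`);
* `integrableOn_reversedDensity` — a function `w ≥ 0`, continuous on `M × (α, β)`, with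
  `∫ w(·, σ) dV_{h(−σ)} ≤ 1` for `σ ∈ (α, β)`, is integrable on `M × (α, β)` for `dV_{h(0)} ⊗ dσ`
  (the density ratio `dV_{h(−σ)}/dV_{h(0)}` is bounded below on the compact slab).

Everything is proved; no definitions, no named facts.

## References

* R. H. Bamler, *Entropy and heat kernel bounds on a Ricci flow background*, arXiv:2008.07093
  (2020), §2.3, Thm. 4.1. [Bamler2020Entropy]
-/

noncomputable section

open Bundle Set Function Filter Manifold MeasureTheory Measure TopologicalSpace
open scoped Manifold ContDiff Topology ENNReal NNReal

namespace Literature.Geometry.Riemannian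

open Lorentzian Lorentzian.PseudoRiemannianMetric

section Integrability

variable {m : ℕ} {H : Type*} [TopologicalSpace H]
  {I : ModelWithCorners ℝ (EuclideanSpace ℝ (Fin m)) H} [I.Boundaryless]
  {M : Type*} [TopologicalSpace M] [ChartedSpace H M] [IsManifold I ∞ M]
  [T2Space M] [CompactSpace M] [SecondCountableTopology M] [MeasurableSpace M] [BorelSpace M]
  {h : ℝ → PseudoRiemannianMetric I ∞ (EuclideanSpace ℝ (Fin m)) (TangentSpace I : M → Type _)}
  {cov : ℝ → CovariantDerivative I (EuclideanSpace ℝ (Fin m)) (TangentSpace I : M → Type _)}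

omit [I.Boundaryless] [T2Space M] [CompactSpace M] [SecondCountableTopology M] [MeasurableSpace M]
  [BorelSpace M] in
/-- **The adjoint heat bracket of a test function vanishes outside its support**: for any family
of metrics `g`, reference metric `g₀`, coefficient `Q` and `p ∉ tsupport ζ`,
`−∂ₛ(ρζ)(p) − ρ Δ_{g(s)}ζ (p) + ρ Q ζ (p) = 0` (`ρ = dV_{g(s)}/dV_{g₀}` smooth in `s`). Duplicate of
`heatAdjoint_eq_zero_of_notMem_tsupport` (`LinearHeatWeakExistence.lean`, family named `h` there),
kept as a deprecated alias (dedup-02466). [folklore] -/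
@[deprecated heatAdjoint_eq_zero_of_notMem_tsupport (since := "2026-08-16")]
theorem heatBracket_eq_zero_of_notMem_tsupport
    {g : ℝ → PseudoRiemannianMetric I ∞ (EuclideanSpace ℝ (Fin m)) (TangentSpace I : M → Type _)}
    {g₀ : PseudoRiemannianMetric I ∞ (EuclideanSpace ℝ (Fin m)) (TangentSpace I : M → Type _)}
    {Q : ℝ → M → ℝ} {ζ : M × ℝ → ℝ} {p : M × ℝ} (hp : p ∉ tsupport ζ) :
    -(deriv (fun s ↦ (g s).densityRatio g₀ p.1 * ζ (p.1, s)) p.2) -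
        (g p.2).densityRatio g₀ p.1 * (g p.2).laplaceBeltrami (fun x ↦ ζ (x, p.2)) p.1 +
        (g p.2).densityRatio g₀ p.1 * Q p.2 p.1 * ζ p = 0 :=
  heatAdjoint_eq_zero_of_notMem_tsupport hp

omit [T2Space M] [CompactSpace M] [SecondCountableTopology M] [MeasurableSpace M] [BorelSpace M] in
/-- **The adjoint heat bracket of a smooth test function is continuous** (for a `C^∞` family `g`,
a Riemannian reference metric `g₀` and a smooth coefficient `Q`). [folklore] -/
theorem continuous_heatBracket
    {g : ℝ → PseudoRiemannianMetric I ∞ (EuclideanSpace ℝ (Fin m)) (TangentSpace I : M → Type _)}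
    {g₀ : PseudoRiemannianMetric I ∞ (EuclideanSpace ℝ (Fin m)) (TangentSpace I : M → Type _)}
    (hg : IsContMDiffFamilyOn ∞ g univ) (hgR : ∀ s, (g s).IsRiemannian) (hR₀ : g₀.IsRiemannian)
    {Q : ℝ → M → ℝ} (hQ : ContMDiff (I.prod 𝓘(ℝ, ℝ)) 𝓘(ℝ, ℝ) ∞ fun p : M × ℝ ↦ Q p.2 p.1)
    {ζ : M × ℝ → ℝ} (hζ : ContMDiff (I.prod 𝓘(ℝ, ℝ)) 𝓘(ℝ, ℝ) ∞ ζ) :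
    Continuous fun p : M × ℝ ↦ -(deriv (fun s ↦ (g s).densityRatio g₀ p.1 * ζ (p.1, s)) p.2) -
        (g p.2).densityRatio g₀ p.1 * (g p.2).laplaceBeltrami (fun x ↦ ζ (x, p.2)) p.1 +
        (g p.2).densityRatio g₀ p.1 * Q p.2 p.1 * ζ p := by
  have hρ : ContMDiff (I.prod 𝓘(ℝ, ℝ)) 𝓘(ℝ, ℝ) ∞ fun p : M × ℝ ↦ (g p.2).densityRatio g₀ p.1 := by
    have := hg.contMDiffOn_densityRatio (g₀ := g₀) (fun s _ ↦ hgR s) hR₀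
    rwa [univ_prod_univ, contMDiffOn_univ] at this
  have hζ' : ContMDiffOn (I.prod 𝓘(ℝ, ℝ)) 𝓘(ℝ, ℝ) ∞
      (fun p : M × ℝ ↦ (fun s y ↦ ζ (y, s)) p.2 p.1) (univ ×ˢ (univ : Set ℝ)) := by
    simpa using hζ.contMDiffOn
  have h1 := Literature.Geometry.Manifold.contMDiff_deriv_time (I := I)
    (u := fun s y ↦ (g s).densityRatio g₀ y * ζ (y, s)) (hρ.mul hζ)
  have h2 := hg.contMDiffOn_laplaceBeltrami (f := fun s y ↦ ζ (y, s)) uniqueDiffOn_univ hζ'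
  simp only [univ_prod_univ, contMDiffOn_univ] at h2
  exact ((h1.neg.sub (hρ.mul h2)).add ((hρ.mul hQ).mul hζ)).continuous

omit [T2Space M] [CompactSpace M] [SecondCountableTopology M] [MeasurableSpace M] [BorelSpace M] in
/-- The adjoint heat bracket of a compactly supported smooth test function is bounded (continuous
and zero off the compact support). [folklore] -/
theorem exists_bound_heatBracket
    {g : ℝ → PseudoRiemannianMetric I ∞ (EuclideanSpace ℝ (Fin m)) (TangentSpace I : M → Type _)}
    {g₀ : PseudoRiemannianMetric I ∞ (EuclideanSpace ℝ (Fin m)) (TangentSpace I : M → Type _)}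
    (hg : IsContMDiffFamilyOn ∞ g univ) (hgR : ∀ s, (g s).IsRiemannian) (hR₀ : g₀.IsRiemannian)
    {Q : ℝ → M → ℝ} (hQ : ContMDiff (I.prod 𝓘(ℝ, ℝ)) 𝓘(ℝ, ℝ) ∞ fun p : M × ℝ ↦ Q p.2 p.1)
    {ζ : M × ℝ → ℝ} (hζ : ContMDiff (I.prod 𝓘(ℝ, ℝ)) 𝓘(ℝ, ℝ) ∞ ζ) (hζc : HasCompactSupport ζ) :
    ∃ C, ∀ p : M × ℝ, |(-(deriv (fun s ↦ (g s).densityRatio g₀ p.1 * ζ (p.1, s)) p.2) -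
        (g p.2).densityRatio g₀ p.1 * (g p.2).laplaceBeltrami (fun x ↦ ζ (x, p.2)) p.1 +
        (g p.2).densityRatio g₀ p.1 * Q p.2 p.1 * ζ p)| ≤ C := by
  obtain ⟨C, hC⟩ := hζc.isCompact.exists_bound_of_continuousOn
    (continuous_heatBracket hg hgR hR₀ hQ hζ).continuousOn
  refine ⟨max C 0, fun p ↦ ?_⟩
  by_cases hp : p ∈ tsupport ζ
  · exact ((Real.norm_eq_abs _).symm.le.trans (hC p hp)).trans (le_max_left _ _)
  · rw [heatAdjoint_eq_zero_of_notMem_tsupport (Q := Q) hp, abs_zero]; exact le_max_right _ _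

/-- **The `L¹` distance of two heat kernel densities is bounded by the strong Feller constant**:
if `ν_{x,t;s} = K dV_s` and `ν_{x',t;s} = K' dV_s` with `K, K' ≥ 0` continuous, then
`∫ |K − K'| dV_s ≤ (π (t − s))^{-1/2} d_{h(t)}(x, x')` (test `sign (K − K')` in
`IsRicciFlow.ofReal_abs_integral_sub_integral_le_of_measurable`). [cite: Bamler2020Entropy, §2.3] -/
theorem IsRicciFlow.ofReal_integral_abs_sub_le (hh : IsContMDiffFamilyOn ∞ h univ)
    (hR : ∀ r, (h r).IsRiemannian) {s t : ℝ} (hst : s < t)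
    (hflow : IsRicciFlow h cov (Icc s t)) {x x' : M} {K K' : M → ℝ} (hK : Continuous K)
    (hK' : Continuous K') (hK0 : ∀ y, 0 ≤ K y) (hK'0 : ∀ y, 0 ≤ K' y)
    (hν : heatKernelMeasure hh hR t x s = (h s).riemVolume.withDensity fun y ↦ ENNReal.ofReal (K y))
    (hν' : heatKernelMeasure hh hR t x' s =
      (h s).riemVolume.withDensity fun y ↦ ENNReal.ofReal (K' y)) :
    ENNReal.ofReal (∫ y, |K y - K' y| ∂(h s).riemVolume) ≤
      ENNReal.ofReal (1 / Real.sqrt (Real.pi * (t - s))) * (h t).edist (hR t) x x' := by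
  haveI : IsFiniteMeasure (h s).riemVolume := ⟨(h s).riemVolume_univ_lt_top⟩
  -- the test function `φ = sign (K − K')`
  set φ : M → ℝ := fun y ↦ if K' y ≤ K y then 1 else -1 with hφ
  have hφm : Measurable φ := Measurable.ite (measurableSet_le hK'.measurable hK.measurable)
    measurable_const measurable_const
  have hφb : ∀ y, |φ y| ≤ 1 := fun y ↦ by simp only [hφ]; split_ifs <;> simp
  have hφabs : ∀ y, φ y * K y - φ y * K' y = |K y - K' y| := fun y ↦ by
    rw [← mul_sub]; simp only [hφ]; split_ifs with hle
    · rw [one_mul, abs_of_nonneg (sub_nonneg.2 hle)]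
    · rw [neg_one_mul, abs_of_neg (sub_neg.2 (not_le.1 hle))]
  have hrepr : ∀ {L : M → ℝ}, Continuous L → (∀ y, 0 ≤ L y) → ∀ {z : M},
      heatKernelMeasure hh hR t z s = (h s).riemVolume.withDensity (fun y ↦ ENNReal.ofReal (L y)) →
      ∫ y, φ y ∂(heatKernelMeasure hh hR t z s) = ∫ y, φ y * L y ∂(h s).riemVolume := by
    intro L hL hL0 z hz
    rw [hz, integral_withDensity_eq_integral_toReal_smul hL.measurable.ennreal_ofReal
      (Eventually.of_forall fun _ ↦ ENNReal.ofReal_lt_top)]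
    refine integral_congr_ae (Eventually.of_forall fun y ↦ ?_)
    show (ENNReal.ofReal (L y)).toReal • φ y = φ y * L y
    rw [ENNReal.toReal_ofReal (hL0 y), smul_eq_mul, mul_comm]
  have hint : ∀ {L : M → ℝ}, Continuous L → Integrable (fun y ↦ φ y * L y) (h s).riemVolume :=
    fun {L} hL ↦ (hL.integrable_of_hasCompactSupport (HasCompactSupport.of_compactSpace _)).bdd_mul
      hφm.aestronglyMeasurable (Eventually.of_forall fun y ↦ by rw [Real.norm_eq_abs]; exact hφb y)
  have key := hflow.ofReal_abs_integral_sub_integral_le_of_measurable hh hR hst hφm zero_le_one hφb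
    ⟨hst, le_rfl⟩ x x'
  rw [one_mul, hrepr hK hK0 hν, hrepr hK' hK'0 hν', ← integral_sub (hint hK) (hint hK')] at key
  simp only [hφabs] at key
  rwa [abs_of_nonneg (integral_nonneg fun y ↦ abs_nonneg _)] at key

/-- **Integrability on a slab of a reversed density of unit mass**: if `w ≥ 0` is continuous on
`M × (α, β)` and `∫ w(y, σ) dV_{h(−σ)}(y) ≤ 1` for every `σ ∈ (α, β)` (in the form
`(V_{h(−σ)} with density w(·,σ)) (M) ≤ 1`), then `w` is integrable on `M × (α, β)` for
`dV_{h(0)} ⊗ dσ` (the density ratio `dV_{h(−σ)}/dV_{h(0)} ≥ c > 0` on the compact slab).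
[folklore] -/
theorem integrableOn_reversedDensity (hh : IsContMDiffFamilyOn ∞ h univ)
    (hR : ∀ r, (h r).IsRiemannian) {α β : ℝ} (hαβ : α < β) {w : M × ℝ → ℝ}
    (hwc : ContinuousOn w (univ ×ˢ Ioo α β)) (hw0 : ∀ p ∈ univ ×ˢ Ioo α β, 0 ≤ w p)
    (hmass : ∀ σ ∈ Ioo α β,
      ((h (-σ)).riemVolume.withDensity fun y ↦ ENNReal.ofReal (w (y, σ))) univ ≤ 1) :
    IntegrableOn w (univ ×ˢ Ioo α β) ((h 0).riemVolume.prod (volume : Measure ℝ)) := by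
  set μ₀ : Measure M := (h 0).riemVolume with hμ₀
  haveI : IsFiniteMeasure μ₀ := ⟨(h 0).riemVolume_univ_lt_top⟩
  have hOm : MeasurableSet ((univ : Set M) ×ˢ Ioo α β) := MeasurableSet.univ.prod measurableSet_Ioo
  -- the density ratio is bounded below on `M × [α, β]`
  set ρ : M × ℝ → ℝ := fun p ↦ (h (-p.2)).densityRatio (h 0) p.1 with hρ
  have hρc : Continuous ρ := (contMDiff_densityRatio_comp_neg hh hR).continuous
  have hρpos : ∀ p, 0 < ρ p := fun p ↦ densityRatio_pos (hR _) (hR 0) _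
  obtain ⟨c, hc, hcρ⟩ : ∃ c, 0 < c ∧ ∀ p ∈ (univ : Set M) ×ˢ Ioo α β, c ≤ ρ p := by
    rcases isEmpty_or_nonempty M with hM | hM
    · exact ⟨1, one_pos, fun p _ ↦ (IsEmpty.false p.1).elim⟩
    obtain ⟨p₀, -, hp₀⟩ := (isCompact_univ.prod (isCompact_Icc (a := α) (b := β))).exists_isMinOn
      ⟨((Classical.arbitrary M), α), mem_univ _, le_rfl, hαβ.le⟩ hρc.continuousOn
    exact ⟨ρ p₀, hρpos p₀, fun p hp ↦ hp₀ ⟨mem_univ _, Ioo_subset_Icc_self hp.2⟩⟩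
  -- measurability on the slab
  have hwm : AEStronglyMeasurable w ((μ₀.prod (volume : Measure ℝ)).restrict (univ ×ˢ Ioo α β)) :=
    hwc.aestronglyMeasurable hOm
  refine ⟨hwm, ?_⟩
  -- `∫⁻ ‖w‖ ≤ (1/c) · (β − α)`: slice-wise `∫⁻ ‖w(·,σ)‖ dμ₀ ≤ 1/c`
  have hslice : ∀ σ ∈ Ioo α β, ∫⁻ y, ‖w (y, σ)‖ₑ ∂μ₀ ≤ ENNReal.ofReal (1 / c) := by
    intro σ hσ
    have hwy : ∀ y, 0 ≤ w (y, σ) := fun y ↦ hw0 (y, σ) ⟨mem_univ _, hσ⟩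
    have hwyc : Continuous fun y ↦ w (y, σ) :=
      (hwc.comp_continuous (continuous_id.prodMk continuous_const) fun y ↦ ⟨mem_univ _, hσ⟩ :)
    -- `1 ≥ ∫⁻ ofReal w dV_{h(−σ)} = ∫⁻ ofReal w · ofReal ρ dμ₀ ≥ ofReal c · ∫⁻ ‖w‖ dμ₀`
    have h1 := hmass σ hσ
    rw [withDensity_apply _ MeasurableSet.univ, Measure.restrict_univ,
      riemVolume_eq_withDensity_densityRatio (hR (-σ)) (hR 0),
      lintegral_withDensity_eq_lintegral_mul _ (continuous_densityRatio (hR (-σ)) (hR 0)).measurable.ennreal_ofReal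
        hwyc.measurable.ennreal_ofReal] at h1
    have h2 : ∫⁻ y, ENNReal.ofReal c * ‖w (y, σ)‖ₑ ∂μ₀ ≤ 1 := by
      refine (lintegral_mono fun y ↦ ?_).trans h1
      rw [Pi.mul_apply, Real.enorm_eq_ofReal (hwy y)]
      gcongr
      exact hcρ (y, σ) ⟨mem_univ _, hσ⟩
    rw [lintegral_const_mul _ hwyc.measurable.enorm] at h2
    have hc' : ENNReal.ofReal c ≠ 0 := by simpa using hc
    calc ∫⁻ y, ‖w (y, σ)‖ₑ ∂μ₀ = (ENNReal.ofReal c)⁻¹ * (ENNReal.ofReal c * ∫⁻ y, ‖w (y, σ)‖ₑ ∂μ₀) := by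
          rw [← mul_assoc, ENNReal.inv_mul_cancel hc' ENNReal.ofReal_ne_top, one_mul]
      _ ≤ (ENNReal.ofReal c)⁻¹ * 1 := by gcongr
      _ = ENNReal.ofReal (1 / c) := by rw [mul_one, one_div, ENNReal.ofReal_inv_of_pos hc]
  show ∫⁻ p, ‖w p‖ₑ ∂((μ₀.prod (volume : Measure ℝ)).restrict (univ ×ˢ Ioo α β)) < ⊤
  have hwm' : AEMeasurable (fun p ↦ ‖w p‖ₑ) (μ₀.prod (volume.restrict (Ioo α β))) := by
    have := hwm.aemeasurable.enorm
    rwa [← Measure.prod_restrict, Measure.restrict_univ] at this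
  rw [← Measure.prod_restrict, Measure.restrict_univ, lintegral_prod_symm _ hwm']
  calc ∫⁻ σ, ∫⁻ y, ‖w (y, σ)‖ₑ ∂μ₀ ∂(volume.restrict (Ioo α β))
      ≤ ∫⁻ _, ENNReal.ofReal (1 / c) ∂(volume.restrict (Ioo α β)) :=
        lintegral_mono_ae ((ae_restrict_mem measurableSet_Ioo).mono fun σ hσ ↦ hslice σ hσ)
    _ < ⊤ := by
        rw [lintegral_const, Measure.restrict_apply MeasurableSet.univ, univ_inter, Real.volume_Ioo]
        exact ENNReal.mul_lt_top ENNReal.ofReal_lt_top ENNReal.ofReal_lt_top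

end Integrability

end Literature.Geometry.Riemannian
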